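import Literature.Computability.Cryptography.KCNFToWordRAMInput
import Literature.Computability.FineGrained.CliqueETHTMBridge
import Literature.Computability.Complexity.StackMachinesTM2
import Literature.Computability.Complexity.TimeBoundsProofs
import HarnessLib

/-!
# ETH-hardness of `k`-Clique: the change of machine model (word RAM ⟶ multi-stack machines)

This file discharges the named fact
`Literature.Computability.FineGrained.sparseKSATInExpTime_of_liberalSparseKSATInRAMTime`
(`CliqueETHTMBridge.lean`), the last hypothesis of the Turing-machine route
`not_kClique_inTimeInst_of_eth_of_tm'` (`CliqueETHLiberalReduction.lean`) to
`Literature.Computability.FineGrained.not_kClique_inTimeInst_of_eth` (**fine-grained.S23**, Chen–Huang–Kanj–Xia,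
JCSS 72 (2006), Thm. 5.5): for `k ≥ 2`, if for every density `c'` and every `δ > 0` some
deterministic word-RAM program decides the sparse `k`-CNFs of density `c'` in time `O(2^{δ n})`
(`LiberalSparseKSATInRAMTime k c' δ`), then for every density `c` and every `δ > 0` some
multi-stack Turing machine (`Turing.FinTM2`) decides the sparse `k`-CNFs of density `c` in time
`2^{δ n} · poly(L)` (`SparseKSATInExpTime k c δ`). This is the folklore simulation of random-access
machines by multitape Turing machines with polynomial overhead (Cook–Reckhow, JCSS 7 (1973), §2;
Korte–Vygen, *Combinatorial Optimization* (2002), §15.2, p. 341), assembled from the verified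
pieces of the tree:

* the input transducer `LightSearch.exists_recode_machine` (Wave0's `Γ'`-code of a `KCNF k` to the
  token code `bits (hdrToks n ++ formulaToks (formulaOf φ))`, linear time);
* the front end `KCNFToRAM.runs_frontEnd` (token code to the memory log of the word RAM started
  on the padded clause list, `KCNFToWordRAMInput.lean`);
* the interpreter `WordRAM.ToTM2.runs_interp` of word-RAM programs by structured stack programs,
  with `runs_readOutBit` / `runs_cleanup` (`WordRAMToTM2Interp.lean`);
* the compilation of structured stack programs to `FinTM2` (`Com.outputsWithin_of_runs_equiv`,
  `StackMachinesTM2.lean`) and the sequential composition of TM2 machines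
  (`TM2ComputableAux.comp_outputsWithin`).

Contents:

* `padded φ` — the clause list handed to the RAM: `φ.clauses` preceded by the tautological
  clause `x_{n-1} ∨ ¬x_{n-1}` (so that `CNF.numVars (padded φ) = n` exactly; `k ≥ 2` is used here);
  `wordsOf_formulaOf` — **the memory image built by the front end is `|x| :: x` for the `CNFSAT`
  input `x = encodeCNFWords (padded φ)`** (when `φ` has no empty clause and `n ≥ 1`);
* `decideProg kW M` — the whole stack program: front end, then a three-way branch (empty clause
  ⟹ answer `false`; `n = 0` ⟹ answer `true`; otherwise clear `nb`, interpret `M`, read the answer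
  bit), then `cleanup`; `runs_decideProg_nil_mem` / `runs_decideProg_zero` / `runs_decideProg_run`
  — its specification in the three cases, with the explicit cost
  `frontCost + 2 T + runCost M W β Elen ns` (`runs_runPath`: `runs_interp` between `clear nb` and
  `runs_readOutBit`, the initial memory represented by the front end's log via `wordsOf_formulaOf`,
  `logLookup_of_perm_segLog` and `init_mem_eq_getD`);
* the time analysis in one variable `Z = κ₀ · (L + 1)(n + 1) · (N + 1)` (`zvar`; `N` the step
  budget `⌊C · 2^{δ n / 5} + C⌋₊` of the RAM, `κ₀ = 4 kW + maxConst M + pcBound M + 7`): every stage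
  costs `O(Z⁴)` (`instrCost_le_pow`, `runCost_le_pow`, `frontCost_le_pow`, `total_le_pow`:
  at most `7000 Z⁴` steps in all), and `Z⁴ = O(2^{δ n} (L + 1)⁴)` (`zvar_pow_le`: the fourth power
  of the budget is `2^{4 δ n / 5}` and `(n + 1)⁴ ≤ C' 2^{δ n / 5}` by `exists_pow_le_two_rpow`);
* `machine kW M` (the compiled `FinTM2`) and
  `sparseKSATInExpTime_of_liberalSparseKSATInRAMTime_holds`.

Design notes. The word size handed to the RAM is `W = 6 (k' + 1) · (T + n + 1)` (`wsz`), `T` the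
number of tokens: every word of the image is `≤ 2 n + T + 5 < W < 2^W` (`bnd_lt_wsz`), so the input
is stored exactly and `k' · (n + inputWidth x) ≤ W`; the RAM program of the hypothesis is taken at
density `c + 1` (the padding clause) and exponent `δ / 5`. Nothing here is specific to `k`-SAT
beyond the front end; the interpreter and its cost are those of `WordRAMToTM2Interp.lean`.

## References

* S. A. Cook, R. A. Reckhow, *Time bounded random access machines*, JCSS 7 (1973) 354–375, §2.
* B. Korte, J. Vygen, *Combinatorial Optimization*, Springer 2002, §15.2, p. 341.
* J. Chen, X. Huang, I. A. Kanj, G. Xia, *Strong computational lower bounds via parameterized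
  complexity*, JCSS 72 (2006) 1346–1367, Thm. 5.5.
* V. Vassilevska Williams, *On some fine-grained questions in algorithms and complexity*,
  Proc. ICM 2018, §2 (robustness of the hypotheses under the machine model).
-/

namespace Literature.Computability.FineGrained

open _root_.Computability Turing Complexity Complexity.Com Cryptography Cryptography.WordRAM
open Cryptography.WordRAM.ToTM2 Cryptography.WordRAM.ToTM2.St Cryptography.KCNFToRAM LightSearch

namespace SparseSatBridge

variable {k : ℕ}

/-! ### The padded clause list -/

/-- The padding clause `x_{n-1} ∨ ¬x_{n-1}` (a tautology mentioning the top variable). [folklore] -/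
def padClause (n : ℕ) : Clause ℕ := [(n - 1, true), (n - 1, false)]

/-- The clause list handed to the word RAM: the clauses of `φ` preceded by the padding clause.
[folklore] -/
def padded (φ : KCNF k) : CNF ℕ := padClause φ.numVars :: φ.clauses

/-- The padded clause list has width `≤ k` when `k ≥ 2`. [folklore] -/
theorem padded_isWidthLE (φ : KCNF k) (hk : 2 ≤ k) : CNF.IsWidthLE k (padded φ) := by
  intro c hc
  rcases List.mem_cons.1 hc with rfl | hc
  · simpa [padClause] using hk
  · exact φ.length_le c hc

/-- The padded clause list has one more clause. [folklore] -/
theorem numClauses_padded (φ : KCNF k) : CNF.numClauses (padded φ) = φ.clauses.length + 1 := rfl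

/-- `foldr max 0` is bounded by any common bound of the entries. [folklore] -/
theorem foldr_max_zero_le {l : List ℕ} {B : ℕ} (h : ∀ x ∈ l, x ≤ B) : l.foldr max 0 ≤ B := by
  induction l with
  | nil => exact Nat.zero_le _
  | cons a l ih =>
    rw [List.foldr_cons]
    exact max_le (h a (by simp)) (ih fun x hx => h x (by simp [hx]))

/-- The padded clause list has exactly `n` variables in the sense of `CNF.numVars` (`n ≥ 1`).
[folklore] -/
theorem numVars_padded (φ : KCNF k) (hn : 1 ≤ φ.numVars) : CNF.numVars (padded φ) = φ.numVars := by
  have hrest : (List.map (fun l : ℕ × Bool => l.1 + 1) φ.clauses.flatten).foldr max 0 ≤ φ.numVars := by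
    refine foldr_max_zero_le fun x hx => ?_
    obtain ⟨l, hl, rfl⟩ := List.mem_map.1 hx
    obtain ⟨c, hc, hlc⟩ := List.mem_flatten.1 hl
    exact φ.fst_lt_numVars c hc l hlc
  have e : CNF.numVars (padded φ) = max (φ.numVars - 1 + 1) (max (φ.numVars - 1 + 1)
      ((List.map (fun l : ℕ × Bool => l.1 + 1) φ.clauses.flatten).foldr max 0)) := rfl
  rw [e]
  omega

/-- `KCNF.eval` is `CNF.eval` of the clause list. [folklore] -/
theorem kcnf_eval_eq (φ : KCNF k) (v : ℕ → Bool) : φ.eval v = CNF.eval φ.clauses v := rfl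

/-- The padding clause is a tautology, so the padded clause list is satisfiable iff `φ` is.
[folklore] -/
theorem satisfiable_padded_iff (φ : KCNF k) : CNF.Satisfiable (padded φ) ↔ φ.Satisfiable := by
  rw [KCNF.satisfiable_iff_exists_eval]
  simp only [CNF.Satisfiable, kcnf_eval_eq, padded, CNF.eval, List.all_cons, Bool.and_eq_true]
  refine exists_congr fun σ => ?_
  have : (padClause φ.numVars).any (Literal.eval σ) = true := by
    cases h : σ (φ.numVars - 1) <;> simp [padClause, Literal.eval, h]
  simp [this]

/-! ### The memory image of the front end is the `CNFSAT` input of the padded clause list -/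

/-- The data words of a clause of `φ`: its length, then its literals as `2 · var + polarity`.
[folklore] -/
def clauseData (c : List (ℕ × Bool)) : List ℕ := c.length :: c.map fun l => 2 * l.1 + l.2.toNat

/-- `encodeCNFWords` through `clauseData`. [folklore] -/
theorem encodeCNFWords_eq' (ψ : CNF ℕ) :
    encodeCNFWords ψ = ψ.numVars :: ψ.numClauses :: ψ.flatMap clauseData := rfl

/-- The word of a coded literal is `2 · var + polarity`. [folklore] -/
theorem litWord_code (l : ℕ × Bool) : litWord (encodeNat l.1, l.2) = 2 * l.1 + l.2.toNat := by
  simp [litWord, bitsToNat_cons, bitsToNat_encodeNat]; ring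

/-- The data words of a coded nonempty clause are its `clauseData`. [folklore] -/
theorem clauseWords_map_code (c : List (ℕ × Bool)) (hc : c ≠ []) :
    KCNFToRAM.clauseWords (c.map fun l => (encodeNat l.1, l.2)) = clauseData c := by
  have hne : (c.map fun l => (encodeNat l.1, l.2)) ≠ [] := by simpa using hc
  simp only [KCNFToRAM.clauseWords, if_neg hne, clauseData, List.length_map, List.map_map]
  congr 1
  exact List.map_congr_left fun l _ => litWord_code l

/-- Without empty clauses, the data words of the coded clause list are the `clauseData` of the
clauses. [folklore] -/
theorem dataWords_formulaOf (φ : KCNF k) (h0 : [] ∉ φ.clauses) :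
    dataWords (formulaOf φ) = φ.clauses.flatMap clauseData := by
  unfold formulaOf
  have key : ∀ cs : List (List (ℕ × Bool)), [] ∉ cs →
      dataWords (cs.map fun c => c.map fun l => (encodeNat l.1, l.2)) = cs.flatMap clauseData := by
    intro cs
    induction cs with
    | nil => intro; rfl
    | cons c cs ih =>
      intro h
      simp only [List.mem_cons, not_or] at h
      rw [List.map_cons, dataWords_cons, List.flatMap_cons, ih h.2, clauseWords_map_code c (Ne.symm h.1)]
  exact key φ.clauses h0

/-- Without empty clauses, the coded clause list has no empty clause. [folklore] -/
theorem filter_ne_nil_formulaOf (φ : KCNF k) (h0 : [] ∉ φ.clauses) :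
    (formulaOf φ).filter (fun c => c ≠ []) = formulaOf φ := by
  rw [List.filter_eq_self]
  intro c hc
  obtain ⟨c', hc', rfl⟩ := List.mem_map.1 hc
  have : c' ≠ [] := fun e => h0 (e ▸ hc')
  simpa using this

/-- `[] ∈ formulaOf φ` iff `φ` has an empty clause. [folklore] -/
theorem nil_mem_formulaOf_iff (φ : KCNF k) : [] ∈ formulaOf φ ↔ [] ∈ φ.clauses := by
  simp only [formulaOf, List.mem_map, List.map_eq_nil_iff]
  constructor
  · rintro ⟨c, hc, rfl⟩; exact hc
  · intro h; exact ⟨[], h, rfl⟩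

/-- The number of coded clauses is the number of clauses. [folklore] -/
theorem length_formulaOf (φ : KCNF k) : (formulaOf φ).length = φ.clauses.length := by
  simp [formulaOf]

/-- **The memory image is the `CNFSAT` input of the padded clause list.** For `φ` without empty
clause and with `n ≥ 1` variables, the word list written by the front end on the header `n` and
the coded clause list `formulaOf φ` is `|x| :: x` for `x = encodeCNFWords (padded φ)`. [folklore] -/
theorem wordsOf_formulaOf (φ : KCNF k) (h0 : [] ∉ φ.clauses) (hn : 1 ≤ φ.numVars) :
    wordsOf φ.numVars (formulaOf φ) =
      (encodeCNFWords (padded φ)).length :: encodeCNFWords (padded φ) := by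
  rw [wordsOf, filter_ne_nil_formulaOf φ h0, length_formulaOf, dataWords_formulaOf φ h0,
    encodeCNFWords_eq', numVars_padded φ hn, numClauses_padded]
  simp [hdrWords, padded, padClause, clauseData]
  all_goals omega

/-! ### Size bounds of the image -/

/-- A clause of `φ` is not longer than the token code of the coded clause list. [folklore] -/
theorem length_clause_le_formulaToks (φ : KCNF k) {c : List (ℕ × Bool)} (hc : c ∈ φ.clauses) :
    c.length ≤ (formulaToks (formulaOf φ)).length := by
  have h1 : ∀ c' : Clause (List Bool), c'.length ≤ (clauseToks c').length := by
    intro c'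
    simp only [clauseToks, List.length_append, List.length_flatMap, List.length_singleton]
    have : c'.length ≤ (c'.map fun l => (litToks l).length).sum := by
      induction c' with
      | nil => simp
      | cons l c ih => simp [litToks] at ih ⊢; omega
    omega
  have h2 : ∀ (F : CNF (List Bool)) (c' : Clause (List Bool)), c' ∈ F →
      (clauseToks c').length ≤ (formulaToks F).length := by
    intro F
    induction F with
    | nil => intro c' h; simp at h
    | cons d F ih =>
      intro c' h
      rw [formulaToks_cons, List.length_append]
      rcases List.mem_cons.1 h with rfl | h
      · omega
      · exact (ih c' h).trans (Nat.le_add_left _ _)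
  have hc' : (c.map fun l => (encodeNat l.1, l.2)) ∈ formulaOf φ := List.mem_map.2 ⟨c, hc, rfl⟩
  have := (h1 _).trans (h2 _ _ hc')
  simpa using this

/-- The memory image has at most `T + 6` words. [folklore] -/
theorem length_wordsOf_le (n : ℕ) (F : CNF (List Bool)) :
    (wordsOf n F).length ≤ (formulaToks F).length + 6 := by
  have := length_dataWords_le F
  simp only [wordsOf, hdrWords, List.length_append, List.length_cons, List.length_nil]
  omega

/-- `Nat.size` is at most the number. [folklore] -/
theorem size_le_self' (x : ℕ) : Nat.size x ≤ x := Nat.size_le.2 Nat.lt_two_pow_self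

/-- The input width of a word list whose length and entries are at most `B` is at most `B + 1`.
[folklore] -/
theorem inputWidth_le_of_forall_le {x : List ℕ} {B : ℕ} (hl : x.length ≤ B) (hx : ∀ v ∈ x, v ≤ B) :
    inputWidth x ≤ B + 1 := by
  unfold inputWidth
  have hf : x.foldr max 1 ≤ B + 1 := by
    clear hl
    induction x with
    | nil => simp
    | cons a l ih =>
      rw [List.foldr_cons]
      exact max_le ((hx a (by simp)).trans (Nat.le_succ _)) (ih fun v hv => hx v (by simp [hv]))
  exact (size_le_self' _).trans (max_le (hl.trans (Nat.le_succ _)) hf)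

/-! ### The program -/

/-- The run path: empty the numeral of `n`, interpret the word-RAM program `M`, read the answer
bit (cell `1` of the final memory). [folklore] -/
def runPath (M : Program) : Com (K ⊕ AReg) :=
  (clear (Sum.inl K.nb) ;; interp M) ;; readOutBit

/-- The branch after the front end: an empty clause (flag `he`) gives the answer `false`; else an
empty numeral of `n` (`n = 0`, hence no clause at all) gives `true`; else the run path (the first
bit of the numeral is consumed by the test, the rest is cleared by the run path). [folklore] -/
def branch (M : Program) : Com (K ⊕ AReg) :=
  ifFlag (Sum.inl K.he) (push (Sum.inl K.out) false)
    (pop (Sum.inl K.nb) (runPath M) (runPath M) (push (Sum.inl K.out) true))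

/-- The whole program of the simulating machine: front end, branch, cleanup. [folklore] -/
def decideProg (kW : ℕ) (M : Program) : Com (K ⊕ AReg) :=
  (frontEnd kW ;; branch M) ;; cleanup

/-- The register file left by the front end: the numeral of `n`, the empty-clause flag, the log,
the ruler, the run flag. [folklore] -/
def feSt (n : ℕ) (e : Bool) (E : List (List Bool × List Bool)) (W : ℕ) : St :=
  { St.zero with nb := encodeNat n, he := flag e, mem := encLog E, wr := ones W, run := [true] }

/-- The register file entering the run path: the tail `w` of the numeral of `n`, the log, the
ruler, the run flag. [folklore] -/
def rpSt (w : List Bool) (E : List (List Bool × List Bool)) (W : ℕ) : St :=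
  { St.zero with nb := w, mem := encLog E, wr := ones W, run := [true] }

/-- The register file at the end of the run path / of the branch: log, ruler, answer. [folklore] -/
def endSt (E : List (List Bool × List Bool)) (W : ℕ) (o : List Bool) : St :=
  { St.zero with mem := encLog E, wr := ones W, out := o }

/-- **The run path.** From `rpSt w E W`, where `E` represents the initial memory of the word RAM
`M` on the input `x` at word size `W` and is bounded by the numeral length of `valueBound M W`,
and given a halting run of `ns` steps ending with `0` or `1` in cell `1`, the run path ends in
`endSt E_f W [answer bit]` within the displayed cost. [folklore] -/
theorem runs_runPath {M : Program} {W : ℕ} {E : List (List Bool × List Bool)} {x : List ℕ} {ns : ℕ}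
    {cf : Cfg} (hrep : Represents E (WordRAM.init W x).mem)
    (hE : BoundedLog (encodeNat (valueBound M W)).length E)
    (hrun : run M W noOracle zeroCoins ns (WordRAM.init W x) = some cf) (hcf : cf.pc = none)
    (hb : cf.mem 1 = 0 ∨ cf.mem 1 = 1) (w : List Bool) :
    ∃ E_f : List (List Bool × List Bool), BoundedLog (encodeNat (valueBound M W)).length E_f ∧
      E_f.length ≤ E.length + ns ∧
      Runs (runPath M) (state (rpSt w E W) F0) (state (endSt E_f W [decide (cf.mem 1 = 1)]) F0)
        (2 * w.length + 1 +
          (ns * (instrCost ((4 * (encodeNat (valueBound M W)).length + 4) * (E.length + ns)) W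
            (encodeNat (valueBound M W)).length (pcBound M) + 2 * pcBound M + 5) + 1) +
          ((4 * (encodeNat (valueBound M W)).length + 4) * (E.length + ns) * 20 + 16)) := by
  set β := (encodeNat (valueBound M W)).length with hβ
  have hwV : 2 ^ W - 1 ≤ valueBound M W := two_pow_sub_one_le_valueBound M W
  have h1V : 1 ≤ valueBound M W := one_le_valueBound M W
  have hMV : M.maxConst ≤ valueBound M W := maxConst_le_valueBound M W
  have hVmem : MemLE (valueBound M W) (WordRAM.init W x).mem := init_memLE W x hwV
  have hpc : ∀ i, (WordRAM.init W x).pc = some i → i ≤ pcBound M := by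
    intro i hi
    simp only [WordRAM.init_pc, Option.some.injEq] at hi
    omega
  obtain ⟨E_f, hrepf, hEf, hlen, hI⟩ :=
    runs_interp hwV h1V hMV (le_of_eq hβ.symm) ns (WordRAM.init W x) hrep hE hVmem hpc hrun hcf
  have c1 : Runs (clear (Sum.inl K.nb)) (state (rpSt w E W) F0)
      (state (cfgSt W E (WordRAM.init W x).pc (flag (WordRAM.init W x).pc.isSome)) F0)
      (2 * w.length + 1) := by
    refine (runs_clear (Sum.inl K.nb : K ⊕ AReg) _).of_eq ?_ ?_
    · funext i; rcases i with i | i <;> cases i <;> rfl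
    · rfl
  have c3 := (c1.seq hI).seq (runs_readOutBit (W := W) hrepf hb)
  refine ⟨E_f, hEf, hlen, c3.of_eq rfl ?_⟩
  have hL : (encLog E_f).length ≤ (4 * β + 4) * (E.length + ns) :=
    (length_encLog_le hEf).trans (Nat.mul_le_mul_left _ hlen)
  have := Nat.mul_le_mul_right 20 hL
  omega

/-- The branch on an empty clause: answer `false`. [folklore] -/
theorem runs_branch_true (M : Program) (n : ℕ) (E : List (List Bool × List Bool)) (W : ℕ) :
    Runs (branch M) (state (feSt n true E W) F0) (state { feSt n true E W with out := [false] } F0) 4 := by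
  refine runs_ifFlag_true _ rfl ((Runs.push _ false _).of_eq ?_ le_rfl)
  funext i; rcases i with i | i <;> cases i <;> rfl

/-- The branch on no empty clause and `n = 0`: answer `true`. [folklore] -/
theorem runs_branch_zero (M : Program) (E : List (List Bool × List Bool)) (W : ℕ) :
    Runs (branch M) (state (feSt 0 false E W) F0) (state { feSt 0 false E W with out := [true] } F0) 6 := by
  refine runs_ifFlag_false _ rfl (Runs.pop_nil _ _ (by rfl) ((Runs.push _ true _).of_eq ?_ le_rfl))
  funext i; rcases i with i | i <;> cases i <;> rfl

/-- The branch on no empty clause and `n ≥ 1` (numeral `b :: w`): the run path from `rpSt w E W`.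
[folklore] -/
theorem runs_branch_run {M : Program} {n : ℕ} {E : List (List Bool × List Bool)} {W : ℕ} {b : Bool}
    {w : List Bool} (hnb : encodeNat n = b :: w) {R' : Regs (K ⊕ AReg)} {B : ℕ}
    (h : Runs (runPath M) (state (rpSt w E W) F0) R' B) :
    Runs (branch M) (state (feSt n false E W) F0) R' (B + 5) := by
  have hk : state (feSt n false E W) F0 (Sum.inl K.nb) = b :: w := by
    change encodeNat n = b :: w; exact hnb
  have hu : Function.update (state (feSt n false E W) F0) (Sum.inl K.nb) w = state (rpSt w E W) F0 := by
    funext i; rcases i with i | i <;> cases i <;> rfl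
  have inner : Runs (pop (Sum.inl K.nb) (runPath M) (runPath M) (push (Sum.inl K.out) true))
      (state (feSt n false E W) F0) R' (B + 2) := by
    cases b with
    | true => exact Runs.pop_true _ _ hk (hu ▸ h)
    | false => exact Runs.pop_false _ _ hk (hu ▸ h)
  have h3 := runs_ifFlag_false (push (Sum.inl K.out) false) (F := Sum.inl K.he)
    (R := state (feSt n false E W) F0) rfl inner
  exact h3.of_eq rfl (by omega)

/-! ### The program on the token code of a `k`-CNF -/

/-- The token code of `φ` (header and coded clause list). [folklore] -/
def toks (φ : KCNF k) : List LightSearch.Tok := hdrToks φ.numVars ++ formulaToks (formulaOf φ)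

/-- The word size of the simulated RAM: `kW · (T + n + 1)`, `T` the number of tokens. [folklore] -/
def wsz (kW : ℕ) (φ : KCNF k) : ℕ := kW * ((toks φ).length + φ.numVars + 1)

/-- The length of the log built by the front end. [folklore] -/
def elen (φ : KCNF k) : ℕ := 6 + (dataWords (formulaOf φ)).length

/-- The uniform bound of the words of the memory image. [folklore] -/
def bnd (φ : KCNF k) : ℕ := 2 * φ.numVars + (toks φ).length + 5

/-- The numeral of `n` is shorter than the token code. [folklore] -/
theorem length_encodeNat_lt_toks (φ : KCNF k) : (encodeNat φ.numVars).length < (toks φ).length := by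
  simp [toks, hdrToks]

/-- The coded clause list has at most `T` tokens. [folklore] -/
theorem length_formulaToks_le_toks (φ : KCNF k) : (formulaToks (formulaOf φ)).length ≤ (toks φ).length := by
  simp [toks]

/-- The log of the front end has at most `T + 6` entries. [folklore] -/
theorem elen_le (φ : KCNF k) : elen φ ≤ (toks φ).length + 6 := by
  have := length_dataWords_le (formulaOf φ)
  have := length_formulaToks_le_toks φ
  unfold elen; omega

/-- Every word of the memory image is at most `bnd φ`. [folklore] -/
theorem wordsOf_le_bnd (φ : KCNF k) {v : ℕ} (hv : v ∈ wordsOf φ.numVars (formulaOf φ)) : v ≤ bnd φ := by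
  have hD := length_dataWords_le (formulaOf φ)
  have hm := length_filter_le_formulaToks (formulaOf φ)
  have hT := length_formulaToks_le_toks φ
  unfold bnd
  rw [wordsOf, List.mem_append] at hv
  rcases hv with hv | hv
  · simp only [hdrWords, List.mem_cons, List.not_mem_nil, or_false] at hv
    rcases hv with rfl | rfl | rfl | rfl | rfl | rfl <;> omega
  · rw [dataWords, List.mem_flatMap] at hv
    obtain ⟨c', hc', hv⟩ := hv
    simp only [formulaOf, List.mem_map] at hc'
    obtain ⟨c, hc, rfl⟩ := hc'
    by_cases hce : c = []
    · subst hce; simp [KCNFToRAM.clauseWords] at hv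
    · rw [clauseWords_map_code c hce] at hv
      simp only [clauseData, List.mem_cons, List.mem_map] at hv
      rcases hv with rfl | ⟨l, hl, rfl⟩
      · have := length_clause_le_formulaToks φ hc; omega
      · have := φ.fst_lt_numVars c hc l hl
        have hb : l.2.toNat ≤ 1 := Bool.toNat_le l.2
        omega

/-- The memory image has at most `bnd φ + 1` words. [folklore] -/
theorem length_wordsOf_le_bnd (φ : KCNF k) : (wordsOf φ.numVars (formulaOf φ)).length ≤ bnd φ + 1 := by
  have := length_wordsOf_le φ.numVars (formulaOf φ)
  have := length_formulaToks_le_toks φ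
  unfold bnd; omega

/-- The word bound is below the word size (`kW ≥ 5`; the token code is never empty). [folklore] -/
theorem bnd_lt_wsz {kW : ℕ} (hkW : 5 ≤ kW) (φ : KCNF k) : bnd φ < wsz kW φ := by
  have hT : 1 ≤ (toks φ).length := by simp [toks, hdrToks]; omega
  have : 5 * ((toks φ).length + φ.numVars + 1) ≤ wsz kW φ := Nat.mul_le_mul_right _ hkW
  unfold bnd; omega

/-- Hence the words of the image fit into a word. [folklore] -/
theorem bnd_lt_two_pow {kW : ℕ} (hkW : 5 ≤ kW) (φ : KCNF k) : bnd φ < 2 ^ wsz kW φ :=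
  (bnd_lt_wsz hkW φ).trans Nat.lt_two_pow_self

/-- The log of the front end is bounded by the numeral length of the value bound of any program at
the word size `wsz kW φ`. [folklore] -/
theorem boundedLog_frontEnd {kW : ℕ} (hkW : 5 ≤ kW) (M : Program) (φ : KCNF k)
    {E : List (List Bool × List Bool)} (hperm : E.Perm (segLog 0 (wordsOf φ.numVars (formulaOf φ)))) :
    BoundedLog (encodeNat (valueBound M (wsz kW φ))).length E := by
  have h2 := bnd_lt_two_pow hkW φ
  have hV := two_pow_sub_one_le_valueBound M (wsz kW φ)
  have h1 : 1 ≤ 2 ^ wsz kW φ := Nat.one_le_two_pow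
  refine boundedLog_of_perm_segLog hperm ((length_wordsOf_le_bnd φ).trans (by omega)) fun v hv => ?_
  have := wordsOf_le_bnd φ hv
  omega

/-- The cost of the run path, the branch and the cleanup beyond the front end, in terms of the word
size `W`, the numeral bound `β`, the log length `Elen` and the number `ns` of simulated steps.
[folklore] -/
def runCost (M : Program) (W β Elen ns : ℕ) : ℕ :=
  ns * (instrCost ((4 * β + 4) * (Elen + ns)) W β (pcBound M) + 2 * pcBound M + 5) +
    (4 * β + 4) * (Elen + ns) * 22 + 2 * W + 30

/-- `runCost` is monotone in the number of steps. [folklore] -/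
theorem runCost_mono (M : Program) (W β Elen : ℕ) {ns ns' : ℕ} (h : ns ≤ ns') :
    runCost M W β Elen ns ≤ runCost M W β Elen ns' := by
  unfold runCost
  have h1 : (4 * β + 4) * (Elen + ns) ≤ (4 * β + 4) * (Elen + ns') := Nat.mul_le_mul_left _ (by omega)
  have h2 := instrCost_mono h1 W β (pcBound M)
  have h3 : ns * (instrCost ((4 * β + 4) * (Elen + ns)) W β (pcBound M) + 2 * pcBound M + 5) ≤
      ns' * (instrCost ((4 * β + 4) * (Elen + ns')) W β (pcBound M) + 2 * pcBound M + 5) :=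
    Nat.mul_le_mul h (by omega)
  have h4 := Nat.mul_le_mul_right 22 h1
  omega

/-- The initial register file of the program on `φ`. [folklore] -/
def inSt (φ : KCNF k) : St := { St.zero with inp := bits (toks φ) }

/-- The final register file: the answer bit. [folklore] -/
def outSt (b : Bool) : St := { St.zero with out := [b] }

/-- The branch on no empty clause and an empty numeral of `n`: answer `true`. [folklore] -/
theorem runs_branch_zero' (M : Program) {n : ℕ} (hnb : encodeNat n = []) (E : List (List Bool × List Bool))
    (W : ℕ) : Runs (branch M) (state (feSt n false E W) F0) (state { feSt n false E W with out := [true] } F0) 6 := by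
  have hk : state (feSt n false E W) F0 (Sum.inl K.nb) = [] := by change encodeNat n = []; exact hnb
  refine runs_ifFlag_false _ rfl (Runs.pop_nil _ _ hk ((Runs.push _ true _).of_eq ?_ le_rfl))
  funext i; rcases i with i | i <;> cases i <;> rfl

/-- **The program on a `k`-CNF with an empty clause**: answer `false`. [folklore] -/
theorem runs_decideProg_nil_mem {kW : ℕ} (hkW : 5 ≤ kW) (M : Program) (φ : KCNF k) (h0 : [] ∈ φ.clauses) :
    Runs (decideProg kW M) (state (inSt φ) F0) (state (outSt false) F0)
      (frontCost kW φ.numVars (toks φ).length + 2 * (toks φ).length +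
        runCost M (wsz kW φ) (encodeNat (valueBound M (wsz kW φ))).length (elen φ) 0) := by
  obtain ⟨E, hperm, hElen, hfe⟩ := runs_frontEnd kW φ.numVars (formulaOf φ)
  have hdec : decide ([] ∈ formulaOf φ) = true := decide_eq_true ((nil_mem_formulaOf_iff φ).2 h0)
  rw [hdec] at hfe
  have hE := boundedLog_frontEnd hkW M φ hperm
  have htot := (hfe.seq (runs_branch_true M φ.numVars E (wsz kW φ))).seq
    (runs_cleanup (encLog E) (ones (wsz kW φ)) [true] [] (encodeNat φ.numVars) [true] [false])
  refine htot.of_eq rfl ?_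
  have hL : (encLog E).length ≤ (4 * (encodeNat (valueBound M (wsz kW φ))).length + 4) * (elen φ + 0) := by
    rw [Nat.add_zero]; exact (length_encLog_le hE).trans (le_of_eq (by rw [hElen]; rfl))
  have hn := length_encodeNat_lt_toks φ
  have := Nat.mul_le_mul_right 22 hL
  simp only [List.length_replicate, ones, List.length_singleton, List.length_nil, runCost, Nat.zero_mul,
    Nat.zero_add, wsz, toks] at *
  omega

/-- **The program on a `k`-CNF without clauses' variables (`n = 0`) and without empty clause**:
answer `true`. [folklore] -/
theorem runs_decideProg_zero {kW : ℕ} (hkW : 5 ≤ kW) (M : Program) (φ : KCNF k) (h0 : [] ∉ φ.clauses)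
    (hn : φ.numVars = 0) :
    Runs (decideProg kW M) (state (inSt φ) F0) (state (outSt true) F0)
      (frontCost kW φ.numVars (toks φ).length + 2 * (toks φ).length +
        runCost M (wsz kW φ) (encodeNat (valueBound M (wsz kW φ))).length (elen φ) 0) := by
  obtain ⟨E, hperm, hElen, hfe⟩ := runs_frontEnd kW φ.numVars (formulaOf φ)
  have hdec : decide ([] ∈ formulaOf φ) = false := decide_eq_false (mt (nil_mem_formulaOf_iff φ).1 h0)
  rw [hdec] at hfe
  have hE := boundedLog_frontEnd hkW M φ hperm
  have hnb : encodeNat φ.numVars = [] := by rw [hn]; decide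
  have htot := (hfe.seq (runs_branch_zero' M hnb E (wsz kW φ))).seq
    (runs_cleanup (encLog E) (ones (wsz kW φ)) [true] [] (encodeNat φ.numVars) [] [true])
  refine htot.of_eq rfl ?_
  have hL : (encLog E).length ≤ (4 * (encodeNat (valueBound M (wsz kW φ))).length + 4) * (elen φ + 0) := by
    rw [Nat.add_zero]; exact (length_encLog_le hE).trans (le_of_eq (by rw [hElen]; rfl))
  have hn' := length_encodeNat_lt_toks φ
  have := Nat.mul_le_mul_right 22 hL
  simp only [List.length_replicate, ones, List.length_singleton, List.length_nil, runCost, Nat.zero_mul,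
    Nat.zero_add, wsz, toks] at *
  omega

/-- **The program on a `k`-CNF with `n ≥ 1` and without empty clause, given a halting run of the
word RAM** on `encodeCNFWords (padded φ)` at word size `wsz kW φ` ending with `0` or `1` in cell
`1`: the answer is that bit. [folklore] -/
theorem runs_decideProg_run {kW : ℕ} (hkW : 5 ≤ kW) {M : Program} (φ : KCNF k) (h0 : [] ∉ φ.clauses)
    (hn : 1 ≤ φ.numVars) {ns : ℕ} {cf : Cfg}
    (hrun : run M (wsz kW φ) noOracle zeroCoins ns
      (WordRAM.init (wsz kW φ) (encodeCNFWords (padded φ))) = some cf)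
    (hcf : cf.pc = none) (hb : cf.mem 1 = 0 ∨ cf.mem 1 = 1) :
    Runs (decideProg kW M) (state (inSt φ) F0) (state (outSt (decide (cf.mem 1 = 1))) F0)
      (frontCost kW φ.numVars (toks φ).length + 2 * (toks φ).length +
        runCost M (wsz kW φ) (encodeNat (valueBound M (wsz kW φ))).length (elen φ) ns) := by
  obtain ⟨E, hperm, hElen, hfe⟩ := runs_frontEnd kW φ.numVars (formulaOf φ)
  have hdec : decide ([] ∈ formulaOf φ) = false := decide_eq_false (mt (nil_mem_formulaOf_iff φ).1 h0)
  rw [hdec] at hfe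
  have hE := boundedLog_frontEnd hkW M φ hperm
  have himg := wordsOf_formulaOf φ h0 hn
  have hB2 := bnd_lt_two_pow hkW φ
  have hxb : ∀ v ∈ encodeCNFWords (padded φ), v < 2 ^ wsz kW φ := fun v hv =>
    lt_of_le_of_lt (wordsOf_le_bnd φ (by rw [himg]; exact List.mem_cons_of_mem _ hv)) hB2
  have hl : (encodeCNFWords (padded φ)).length < 2 ^ wsz kW φ :=
    lt_of_le_of_lt (wordsOf_le_bnd φ (by rw [himg]; exact List.mem_cons_self)) hB2
  have hrep : Represents E (WordRAM.init (wsz kW φ) (encodeCNFWords (padded φ))).mem := fun a => by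
    rw [logLookup_of_perm_segLog hperm a, himg, init_mem_eq_getD _ _ hxb hl a]
  have h00 : encodeNat 0 = [] := by decide
  obtain ⟨b, w, hnb⟩ : ∃ (b : Bool) (w : List Bool), encodeNat φ.numVars = b :: w := by
    cases h : encodeNat φ.numVars with
    | nil =>
      have : φ.numVars = 0 := encodeNat_eq_encodeNat_iff.1 (h.trans h00.symm)
      omega
    | cons b w => exact ⟨b, w, rfl⟩
  obtain ⟨E_f, hEf, hlen, hrp⟩ := runs_runPath hrep hE hrun hcf hb w
  have hbr := runs_branch_run hnb hrp
  have htot := (hfe.seq hbr).seq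
    (runs_cleanup (encLog E_f) (ones (wsz kW φ)) [] [] [] [] [decide (cf.mem 1 = 1)])
  refine htot.of_eq rfl ?_
  have hEl : E.length = elen φ := hElen
  have hL : (encLog E_f).length ≤ (4 * (encodeNat (valueBound M (wsz kW φ))).length + 4) * (elen φ + ns) :=
    (length_encLog_le hEf).trans (Nat.mul_le_mul_left _ (by rw [hEl] at hlen; exact hlen))
  have hn' := length_encodeNat_lt_toks φ
  rw [hnb, List.length_cons] at hn'
  rw [hEl]
  have := Nat.mul_le_mul_right 22 hL
  simp only [List.length_replicate, ones, List.length_nil, runCost, Nat.add_zero, wsz, toks] at *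
  omega

/-! ### Cost bounds in one variable `Z` -/

/-- One instruction costs `O(Z³)` when word size, numeral bound, counter bound are `≤ Z` and the
log code has length `≤ 8 Z²`. [folklore] -/
theorem instrCost_le_pow {Z W β Q P : ℕ} (hZ : 1 ≤ Z) (hW : W ≤ Z) (hβ : β ≤ Z) (hQ : Q ≤ 8 * Z ^ 2)
    (hP : P ≤ Z) : instrCost Q W β P ≤ 5000 * Z ^ 3 := by
  have hZ2 : Z ≤ Z ^ 2 := by nlinarith
  have hZ3 : Z ^ 2 ≤ Z ^ 3 := Nat.pow_le_pow_right hZ (by norm_num)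
  have hQβ : Q * (3 * β + 17) ≤ 160 * Z ^ 3 :=
    calc Q * (3 * β + 17) ≤ 8 * Z ^ 2 * (20 * Z) := Nat.mul_le_mul hQ (by omega)
      _ = 160 * Z ^ 3 := by ring
  have hop : opCost W β β ≤ 4000 * Z ^ 2 := by
    unfold opCost
    calc 250 * (W + β + β + 1) ^ 2 ≤ 250 * (4 * Z) ^ 2 :=
          Nat.mul_le_mul_left _ (Nat.pow_le_pow_left (by omega) 2)
      _ = 4000 * Z ^ 2 := by ring
  unfold instrCost loadCost storeCost
  omega

/-- The run path, branch and cleanup cost `O(Z⁴)`. [folklore] -/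
theorem runCost_le_pow {M : Program} {Z W β Elen ns : ℕ} (hZ : 1 ≤ Z) (hW : W ≤ Z) (hβ : β ≤ Z)
    (hE : Elen + ns ≤ Z) (hP : pcBound M ≤ Z) (hns : ns ≤ Z) : runCost M W β Elen ns ≤ 5215 * Z ^ 4 := by
  have hQ : (4 * β + 4) * (Elen + ns) ≤ 8 * Z ^ 2 :=
    calc (4 * β + 4) * (Elen + ns) ≤ (8 * Z) * Z := Nat.mul_le_mul (by omega) hE
      _ = 8 * Z ^ 2 := by ring
  have hI := instrCost_le_pow hZ hW hβ hQ hP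
  have hZ2 : Z ≤ Z ^ 2 := by nlinarith
  have hZ4 : Z ^ 2 ≤ Z ^ 4 := Nat.pow_le_pow_right hZ (by norm_num)
  have h1 : ns * (instrCost ((4 * β + 4) * (Elen + ns)) W β (pcBound M) + 2 * pcBound M + 5) ≤
      5000 * Z ^ 4 + 2 * Z ^ 2 + 5 * Z :=
    calc _ ≤ Z * (5000 * Z ^ 3 + 2 * Z + 5) := Nat.mul_le_mul hns (by omega)
      _ = 5000 * Z ^ 4 + 2 * Z ^ 2 + 5 * Z := by ring
  unfold runCost
  omega

/-- The front end costs `O(Z²)`. [folklore] -/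
theorem frontCost_le_pow {Z kW n Tn : ℕ} (hZ : 1 ≤ Z) (hT : Tn + n + 1 ≤ Z) (hT6 : Tn + 6 ≤ Z)
    (hk : kW + 1 ≤ Z) : frontCost kW n Tn ≤ 1400 * Z ^ 2 := by
  have he := TM2Pass.length_encodeNat_le_self (Tn + 6)
  have htok : tokCostB (Tn + 6) ≤ 211 * Z := by unfold tokCostB; omega
  have h1 : Tn * tokCostB (Tn + 6) ≤ 211 * Z ^ 2 :=
    calc _ ≤ Z * (211 * Z) := Nat.mul_le_mul (by omega) htok
      _ = 211 * Z ^ 2 := by ring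
  have h2 : (n + 1) * (20 * n + 125) ≤ 145 * Z ^ 2 :=
    calc _ ≤ Z * (145 * Z) := Nat.mul_le_mul (by omega) (by omega)
      _ = 145 * Z ^ 2 := by ring
  have h3 : (kW + 1) * (10 * (Tn + n + 1) + 3) ≤ 13 * Z ^ 2 :=
    calc _ ≤ Z * (13 * Z) := Nat.mul_le_mul hk (by omega)
      _ = 13 * Z ^ 2 := by ring
  have hZ2 : Z ≤ Z ^ 2 := by nlinarith
  unfold frontCost postCostB
  omega

/-- `2 ^ W + c < 2 ^ (W + c + 1)`. [folklore] -/
theorem two_pow_add_lt (W c : ℕ) : 2 ^ W + c < 2 ^ (W + c + 1) := by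
  have h1 : 2 ^ W ≤ 2 ^ (W + c) := Nat.pow_le_pow_right (by norm_num) (Nat.le_add_right _ _)
  have h2 : c < 2 ^ (W + c) := lt_of_lt_of_le Nat.lt_two_pow_self (Nat.pow_le_pow_right (by norm_num) (by omega))
  rw [Nat.pow_succ]; omega

/-- The numeral length of the value bound is linear in the word size. [folklore] -/
theorem length_encodeNat_valueBound_le (M : Program) (W : ℕ) :
    (encodeNat (valueBound M W)).length ≤ W + M.maxConst + 1 :=
  length_encodeNat_le_of_lt (lt_of_le_of_lt (valueBound_le M W) (two_pow_add_lt W M.maxConst))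

/-- The scaling constant of the one-variable analysis. [folklore] -/
def kappa (kW : ℕ) (M : Program) : ℕ := 4 * kW + M.maxConst + pcBound M + 7

/-- The variable of the analysis: `Z = κ₀ · (L + 1)(n + 1) · (N + 1)`. [folklore] -/
def zvar (kW : ℕ) (M : Program) (n L Nb : ℕ) : ℕ := kappa kW M * ((L + 1) * (n + 1)) * (Nb + 1)

/-- **The whole machine costs at most `7000 Z⁴` steps**: transducer (`5 L + 3`), compiled program
(front end, branch with a run of at most `Nb` simulated steps, cleanup) and the final step.
[folklore] -/
theorem total_le_pow (kW : ℕ) (M : Program) (φ : KCNF k) (Nb : ℕ) :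
    frontCost kW φ.numVars (toks φ).length + 2 * (toks φ).length +
        runCost M (wsz kW φ) (encodeNat (valueBound M (wsz kW φ))).length (elen φ) Nb + 1 +
      (5 * φ.encode.length + 3) ≤ 7000 * zvar kW M φ.numVars φ.encode.length Nb ^ 4 := by
  obtain ⟨G, hG⟩ : ∃ G, G = (φ.encode.length + 1) * (φ.numVars + 1) := ⟨_, rfl⟩
  obtain ⟨Z, hZ⟩ : ∃ Z, Z = zvar kW M φ.numVars φ.encode.length Nb := ⟨_, rfl⟩
  rw [← hZ]
  have hTn : (toks φ).length ≤ 4 * φ.encode.length :=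
    (length_le_length_bits _).trans (length_bits_hdr_formulaOf_le φ)
  have hG' : G = φ.encode.length * φ.numVars + φ.encode.length + φ.numVars + 1 := by rw [hG]; ring
  have hG1 : 1 ≤ G := by omega
  have hκ : kappa kW M = 4 * kW + M.maxConst + pcBound M + 7 := rfl
  have hZeq : Z = kappa kW M * (G * (Nb + 1)) := by rw [hZ, zvar, hG]; ring
  have hGY : 6 * G + (Nb + 1) ≤ 7 * (G * (Nb + 1)) := by nlinarith
  have hGY' : G ≤ G * (Nb + 1) := Nat.le_mul_of_pos_right _ (by omega)
  have hκG : kappa kW M * G ≤ Z := by rw [hZeq]; exact Nat.mul_le_mul_left _ hGY'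
  have h7G : 7 * G ≤ kappa kW M * G := Nat.mul_le_mul_right _ (by omega)
  have h6G : 6 * G + (Nb + 1) ≤ Z := hGY.trans (by rw [hZeq]; exact Nat.mul_le_mul_right _ (by omega))
  have hkZ : kappa kW M ≤ Z := (Nat.le_mul_of_pos_right _ hG1).trans hκG
  have hZ1 : 1 ≤ Z := by omega
  have h4G : (toks φ).length + φ.numVars + 1 ≤ 4 * G := by omega
  have hwsz : wsz kW φ = kW * ((toks φ).length + φ.numVars + 1) := rfl
  have hW4 : wsz kW φ ≤ 4 * kW * G := by
    have h1 : kW * ((toks φ).length + φ.numVars + 1) ≤ kW * (4 * G) := Nat.mul_le_mul_left _ h4G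
    have h2 : kW * (4 * G) = 4 * kW * G := by ring
    omega
  have h4κ : 4 * kW * G + (M.maxConst + 1) * G ≤ kappa kW M * G := by
    rw [← Nat.add_mul]; exact Nat.mul_le_mul_right _ (by omega)
  have hMG : M.maxConst + 1 ≤ (M.maxConst + 1) * G := Nat.le_mul_of_pos_right _ hG1
  have hW : wsz kW φ ≤ Z := by omega
  have hβ : (encodeNat (valueBound M (wsz kW φ))).length ≤ Z := by
    have h1 := length_encodeNat_valueBound_le M (wsz kW φ)
    omega
  have hE : elen φ + Nb ≤ Z := by have := elen_le φ; omega
  have hP : pcBound M ≤ Z := by omega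
  have hR := runCost_le_pow (M := M) hZ1 hW hβ hE hP (by omega)
  have hF := frontCost_le_pow (kW := kW) (n := φ.numVars) (Tn := (toks φ).length) hZ1 (by omega) (by omega)
    (by omega)
  have hZ2 : Z ≤ Z ^ 2 := by nlinarith
  have hZ4 : Z ^ 2 ≤ Z ^ 4 := Nat.pow_le_pow_right hZ1 (by norm_num)
  omega

/-- **The exponent bookkeeping.** `Z⁴ = O(2^{5 ε n} · (L + 1)⁴)` when the step budget is
`⌊C · 2^{ε n} + C⌋₊`: the fourth power of the budget gives `2^{4 ε n}`, and `(n + 1)⁴ ≤ C' 2^{ε n}`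
(`exists_pow_le_two_rpow`). [folklore] -/
theorem zvar_pow_le (kW : ℕ) (M : Program) (C : ℝ) {ε : ℝ} (hε : 0 < ε) :
    ∃ K : ℝ, 0 ≤ K ∧ ∀ n L : ℕ,
      ((zvar kW M n L ⌊C * (2 : ℝ) ^ (ε * n) + C⌋₊ ^ 4 : ℕ) : ℝ) ≤
        K * (2 : ℝ) ^ (5 * ε * n) * ((L : ℝ) + 1) ^ 4 := by
  obtain ⟨C₉, hC₉0, hC₉⟩ := exists_pow_le_two_rpow 4 hε
  set Cp : ℝ := max C 0 with hCp
  have hCp0 : 0 ≤ Cp := le_max_right _ _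
  refine ⟨(kappa kW M : ℝ) ^ 4 * (2 * Cp + 1) ^ 4 * C₉, by positivity, fun n L => ?_⟩
  have hX1 : (1 : ℝ) ≤ (2 : ℝ) ^ (ε * n) := Real.one_le_rpow (by norm_num) (by positivity)
  have hX0 : (0 : ℝ) ≤ (2 : ℝ) ^ (ε * n) := by linarith
  have hfl : (⌊C * (2 : ℝ) ^ (ε * n) + C⌋₊ : ℝ) ≤ Cp * (2 : ℝ) ^ (ε * n) + Cp := by
    have h1 : C * (2 : ℝ) ^ (ε * n) + C ≤ Cp * (2 : ℝ) ^ (ε * n) + Cp :=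
      add_le_add (mul_le_mul_of_nonneg_right (le_max_left _ _) hX0) (le_max_left _ _)
    have h2 : (0 : ℝ) ≤ Cp * (2 : ℝ) ^ (ε * n) + Cp := by positivity
    exact (Nat.cast_le.2 (Nat.floor_le_floor h1)).trans (Nat.floor_le h2)
  have hY : (⌊C * (2 : ℝ) ^ (ε * n) + C⌋₊ : ℝ) + 1 ≤ (2 * Cp + 1) * (2 : ℝ) ^ (ε * n) := by nlinarith
  have hn4 : ((n : ℝ) + 1) ^ 4 ≤ C₉ * (2 : ℝ) ^ (ε * n) := hC₉ n
  have h1 : (kappa kW M : ℝ) * (((L : ℝ) + 1) * ((n : ℝ) + 1)) * ((⌊C * (2 : ℝ) ^ (ε * n) + C⌋₊ : ℝ) + 1) ≤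
      (kappa kW M : ℝ) * (((L : ℝ) + 1) * ((n : ℝ) + 1)) * ((2 * Cp + 1) * (2 : ℝ) ^ (ε * n)) :=
    mul_le_mul_of_nonneg_left hY (by positivity)
  have hXX : (2 : ℝ) ^ (ε * n) * ((2 : ℝ) ^ (ε * n)) ^ 4 = (2 : ℝ) ^ (5 * ε * n) := by
    rw [← Real.rpow_natCast, ← Real.rpow_mul (by norm_num), ← Real.rpow_add (by norm_num)]
    congr 1; push_cast; ring
  have hmain : ((kappa kW M : ℝ) * (((L : ℝ) + 1) * ((n : ℝ) + 1)) *
      ((⌊C * (2 : ℝ) ^ (ε * n) + C⌋₊ : ℝ) + 1)) ^ 4 ≤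
      (kappa kW M : ℝ) ^ 4 * (2 * Cp + 1) ^ 4 * C₉ * (2 : ℝ) ^ (5 * ε * n) * ((L : ℝ) + 1) ^ 4 := by
    calc _ ≤ ((kappa kW M : ℝ) * (((L : ℝ) + 1) * ((n : ℝ) + 1)) * ((2 * Cp + 1) * (2 : ℝ) ^ (ε * n))) ^ 4 :=
          pow_le_pow_left₀ (by positivity) h1 4
      _ = (kappa kW M : ℝ) ^ 4 * (2 * Cp + 1) ^ 4 * ((n : ℝ) + 1) ^ 4 * ((2 : ℝ) ^ (ε * n)) ^ 4 *
            ((L : ℝ) + 1) ^ 4 := by ring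
      _ ≤ (kappa kW M : ℝ) ^ 4 * (2 * Cp + 1) ^ 4 * (C₉ * (2 : ℝ) ^ (ε * n)) * ((2 : ℝ) ^ (ε * n)) ^ 4 *
            ((L : ℝ) + 1) ^ 4 := by gcongr
      _ = (kappa kW M : ℝ) ^ 4 * (2 * Cp + 1) ^ 4 * C₉ * ((2 : ℝ) ^ (ε * n) * ((2 : ℝ) ^ (ε * n)) ^ 4) *
            ((L : ℝ) + 1) ^ 4 := by ring
      _ = _ := by rw [hXX]
  have e : ((zvar kW M n L ⌊C * (2 : ℝ) ^ (ε * n) + C⌋₊ ^ 4 : ℕ) : ℝ) =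
      ((kappa kW M : ℝ) * (((L : ℝ) + 1) * ((n : ℝ) + 1)) * ((⌊C * (2 : ℝ) ^ (ε * n) + C⌋₊ : ℝ) + 1)) ^ 4 := by
    unfold zvar; push_cast; ring
  rw [e]
  exact hmain

/-! ### Reading the answer of the RAM -/

/-- A one-word output `[v]` means cell `1` holds `v`. [folklore] -/
theorem mem_one_of_readOut_eq_singleton {m : ℕ → ℕ} {v : ℕ} (h : readOut m = [v]) : m 1 = v := by
  have h0 : m 0 = 1 := by simpa using congrArg List.length h
  rw [readOut, h0] at h
  simpa [readSeg] using h

/-! ### The machine and the named fact -/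

/-- The compiled machine of `decideProg kW M` (input register `inp`, output register `out`).
[folklore] -/
noncomputable def machine (kW : ℕ) (M : Program) : TM2ComputableAux Bool Bool :=
  (compile ((decideProg kW M).map (Fintype.equivFin (K ⊕ AReg)))).toAux
    (Fintype.equivFin (K ⊕ AReg) (Sum.inl K.inp)) (Fintype.equivFin (K ⊕ AReg) (Sum.inl K.out))

/-- A run of the program from `inSt φ` to `outSt b` within `B` is a run of the compiled machine on
the token code with output `[b]` within `B + 1`. [folklore] -/
theorem machine_outputsWithin {kW : ℕ} {M : Program} {φ : KCNF k} {b : Bool} {B : ℕ}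
    (h : Runs (decideProg kW M) (state (inSt φ) F0) (state (outSt b) F0) B) :
    (machine kW M).OutputsWithin (bits (toks φ)) [b] (B + 1) := by
  have h' : Runs (decideProg kW M) (Regs.init (Sum.inl K.inp) (bits (toks φ)))
      (Regs.init (Sum.inl K.out) [b]) B := by
    rw [init_inp, init_out]; exact h
  exact Com.outputsWithin_of_runs_equiv (Fintype.equivFin (K ⊕ AReg)) (Or.inl h')

/-- A `k`-CNF with an empty clause is unsatisfiable. [folklore] -/
theorem not_satisfiable_of_nil_mem (φ : KCNF k) (h : [] ∈ φ.clauses) : ¬ φ.Satisfiable := by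
  rw [KCNF.satisfiable_iff_exists_eval]
  rintro ⟨v, hv⟩
  obtain ⟨l, hl, -⟩ := (KCNF.eval_eq_true_iff_forall_exists φ v).1 hv [] h
  simp at hl

/-- A `k`-CNF without variables and without empty clause has no clause, hence is satisfiable.
[folklore] -/
theorem satisfiable_of_numVars_eq_zero (φ : KCNF k) (h0 : [] ∉ φ.clauses) (hn : φ.numVars = 0) :
    φ.Satisfiable := by
  rw [KCNF.satisfiable_iff_exists_eval]
  refine ⟨fun _ => false, (KCNF.eval_eq_true_iff_forall_exists φ _).2 fun c hc => ?_⟩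
  rcases c with _ | ⟨l, c⟩
  · exact absurd hc h0
  · have := φ.fst_lt_numVars _ hc l (by simp)
    omega

end SparseSatBridge

open SparseSatBridge in
/-- **The change of machine model (Cook–Reckhow 1973, §2; Korte–Vygen 2002, §15.2): discharge of
the named fact `sparseKSATInExpTime_of_liberalSparseKSATInRAMTime`.** For `k ≥ 2`, word-RAM
deciders of the sparse `k`-CNFs of every density running in time `O(2^{δ n})` for every `δ > 0`
yield, for every density `c` and every `δ > 0`, a multi-stack Turing machine deciding the sparse
`k`-CNFs of density `c` in time `2^{δ n} · poly(L)`: the machine is the input transducer followed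
by the compiled program `decideProg (6 (k' + 1)) M` for the word-RAM program `M` of density `c + 1`
and exponent `δ / 5`; its running time is `O(Z⁴)` with `Z = O((L + 1)(n + 1) 2^{δ n / 5})`
(`total_le_pow`, `zvar_pow_le`). [cite: CookReckhow1973, §2] [cite: KorteVygen2002, §15.2 (p. 341)] -/
theorem sparseKSATInExpTime_of_liberalSparseKSATInRAMTime_holds :
    sparseKSATInExpTime_of_liberalSparseKSATInRAMTime := by
  intro k c hk hR δ hδ
  have hδ5 : 0 < δ / 5 := by positivity
  obtain ⟨M, k', C, -, -, hM⟩ := hR (c + 1) (δ / 5) hδ5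
  obtain ⟨Mr, hMr⟩ := exists_recode_machine (k := k)
  set kW := 6 * (k' + 1) with hkWdef
  have hkW : 5 ≤ kW := by omega
  obtain ⟨K, hK0, hK⟩ := zvar_pow_le kW M C hδ5
  -- the time bound
  refine ⟨fun n L => 7000 * zvar kW M n L ⌊C * (2 : ℝ) ^ (δ / 5 * n) + C⌋₊ ^ 4, ?_,
    ⟨Mr.comp (machine kW M), fun φ => ?_⟩⟩
  · refine ⟨max ⌈7000 * K⌉₊ 4, fun n L => ?_⟩
    have h1 := hK n L
    have e : 5 * (δ / 5) * (n : ℝ) = δ * n := by ring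
    rw [e] at h1
    have hL : (1 : ℝ) ≤ (L : ℝ) + 1 := by simp
    have hc1 : 7000 * K ≤ ((max ⌈7000 * K⌉₊ 4 : ℕ) : ℝ) :=
      (Nat.le_ceil _).trans (by exact_mod_cast le_max_left _ _)
    have hc2 : ((L : ℝ) + 1) ^ 4 ≤ ((L : ℝ) + 1) ^ (max ⌈7000 * K⌉₊ 4) := pow_le_pow_right₀ hL (le_max_right _ _)
    have h0 : (0 : ℝ) ≤ (2 : ℝ) ^ (δ * n) := by positivity
    show ((7000 * zvar kW M n L ⌊C * (2 : ℝ) ^ (δ / 5 * n) + C⌋₊ ^ 4 : ℕ) : ℝ) ≤ _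
    have e1 : ((7000 * zvar kW M n L ⌊C * (2 : ℝ) ^ (δ / 5 * n) + C⌋₊ ^ 4 : ℕ) : ℝ) =
        7000 * ((zvar kW M n L ⌊C * (2 : ℝ) ^ (δ / 5 * n) + C⌋₊ ^ 4 : ℕ) : ℝ) := by
      rw [Nat.cast_mul]; norm_num
    rw [e1]
    calc (7000 : ℝ) * ((zvar kW M n L ⌊C * (2 : ℝ) ^ (δ / 5 * n) + C⌋₊ ^ 4 : ℕ) : ℝ)
        ≤ 7000 * (K * (2 : ℝ) ^ (δ * n) * ((L : ℝ) + 1) ^ 4) := by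
          exact mul_le_mul_of_nonneg_left h1 (by norm_num)
      _ = (7000 * K) * (2 : ℝ) ^ (δ * n) * ((L : ℝ) + 1) ^ 4 := by ring
      _ ≤ ((max ⌈7000 * K⌉₊ 4 : ℕ) : ℝ) * (2 : ℝ) ^ (δ * n) * ((L : ℝ) + 1) ^ 4 :=
          mul_le_mul_of_nonneg_right (mul_le_mul_of_nonneg_right hc1 h0) (by positivity)
      _ ≤ ((max ⌈7000 * K⌉₊ 4 : ℕ) : ℝ) * (2 : ℝ) ^ (δ * n) * ((L : ℝ) + 1) ^ (max ⌈7000 * K⌉₊ 4) :=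
          mul_le_mul_of_nonneg_left hc2 (by positivity)
  · -- one instance
    obtain ⟨φ, hsp⟩ := φ
    set Nb := ⌊C * (2 : ℝ) ^ (δ / 5 * (φ.numVars : ℝ)) + C⌋₊ with hNb
    have hrec := hMr φ
    suffices hprog : Runs (decideProg kW M) (state (inSt φ) F0) (state (outSt (decide φ.Satisfiable)) F0)
        (frontCost kW φ.numVars (toks φ).length + 2 * (toks φ).length +
          runCost M (wsz kW φ) (encodeNat (valueBound M (wsz kW φ))).length (elen φ) Nb) by
      have h2 := machine_outputsWithin hprog
      have h3 := TM2ComputableAux.comp_outputsWithin Mr (machine kW M) hrec h2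
      exact h3.mono (total_le_pow kW M φ Nb)
    have hmono := fun {a b : ℕ} (h : a ≤ b) =>
      runCost_mono M (wsz kW φ) (encodeNat (valueBound M (wsz kW φ))).length (elen φ) h
    by_cases h0 : [] ∈ φ.clauses
    · have hd : decide φ.Satisfiable = false := decide_eq_false (not_satisfiable_of_nil_mem φ h0)
      rw [hd]
      refine (runs_decideProg_nil_mem hkW M φ h0).mono ?_
      have := hmono (Nat.zero_le Nb)
      omega
    by_cases hn : φ.numVars = 0
    · have hd : decide φ.Satisfiable = true := decide_eq_true (satisfiable_of_numVars_eq_zero φ h0 hn)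
      rw [hd]
      refine (runs_decideProg_zero hkW M φ h0 hn).mono ?_
      have := hmono (Nat.zero_le Nb)
      omega
    have hn1 : 1 ≤ φ.numVars := Nat.one_le_iff_ne_zero.2 hn
    -- the RAM run on the padded clause list
    have hnv := numVars_padded φ hn1
    have hdens : CNF.numClauses (padded φ) ≤ (c + 1) * CNF.numVars (padded φ) := by
      rw [hnv, numClauses_padded, Nat.add_mul, one_mul]
      have : φ.clauses.length ≤ c * φ.numVars := hsp
      omega
    have himg := wordsOf_formulaOf φ h0 hn1
    have hwidth : inputWidth (encodeCNFWords (padded φ)) ≤ bnd φ + 1 :=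
      inputWidth_le_of_forall_le (wordsOf_le_bnd φ (by rw [himg]; exact List.mem_cons_self))
        fun v hv => wordsOf_le_bnd φ (by rw [himg]; exact List.mem_cons_of_mem _ hv)
    have hWsz : k' * (CNF.numVars (padded φ) + inputWidth (encodeCNFWords (padded φ))) ≤ wsz kW φ := by
      rw [hnv]
      have h1 : φ.numVars + inputWidth (encodeCNFWords (padded φ)) ≤ 6 * ((toks φ).length + φ.numVars + 1) := by
        unfold bnd at hwidth; omega
      calc k' * (φ.numVars + inputWidth (encodeCNFWords (padded φ)))
          ≤ k' * (6 * ((toks φ).length + φ.numVars + 1)) := Nat.mul_le_mul_left _ h1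
        _ ≤ (k' + 1) * (6 * ((toks φ).length + φ.numVars + 1)) := Nat.mul_le_mul_right _ (Nat.le_succ _)
        _ = wsz kW φ := by rw [wsz, hkWdef]; ring
    obtain ⟨out, hout, hrunM⟩ := hM (padded φ) (padded_isWidthLE φ hk) hdens (wsz kW φ) hWsz
    rw [CNFSAT_good_iff] at hout
    subst hout
    rw [hnv] at hrunM
    obtain ⟨cf, ⟨hev⟩, hstep, hread⟩ := hrunM
    obtain ⟨ns, hns, hrun, -⟩ := HaltsWithin.exists_run (P := M) ⟨⟨hev⟩, hstep⟩
    rw [← hNb] at hns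
    have hcf : cf.pc = none := (step_eq_none_iff _ _ _ _ _).1 hstep
    have hm1 := mem_one_of_readOut_eq_singleton hread
    have hb : cf.mem 1 = 0 ∨ cf.mem 1 = 1 := by rw [hm1]; split_ifs <;> simp
    have hd : decide (cf.mem 1 = 1) = decide φ.Satisfiable := by
      rw [decide_eq_decide, hm1, ← satisfiable_padded_iff]
      split_ifs with h <;> simp [h]
    rw [← hd]
    refine (runs_decideProg_run hkW φ h0 hn1 hrun hcf hb).mono ?_
    have := hmono hns
    omega

end Literature.Computability.FineGrained
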